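import Summits.Ventures.CertifiedManyBodySolver.Observables.RungLeavesCoverageNdNiO2
import HarnessLib

/-!
# Ventures/CertifiedManyBodySolver — Observables/RungLeavesCoverageNdNiO2Residual.lean

HONEST FRAMING: one-sided certified CEILINGS on the uniform flux stiffness on the DOWNFOLDED d⁹-nickelate boxes of record `boxNdNiO2E_M21`
(NdNiO₂ parent film) and `boxNdSrNiO2E_M22` (Nd₀.₈Sr₀.₂NiO₂) — wording class (xx1): CONTROL / CALIBRATION + labelled heuristic; a ceiling never
speaks to the presence of superconductivity; a downfolded box is a systematic modelling claim (router/BOXES/NdNiO2.md «1BH+3BE»); never «certified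
true negative / positive»; not a `T_c` or phase-diagram statement. Typing certifies nothing about any material; no summit statement is proved here.
Prop-level GLUE and CLOSERS only: every theorem is CONDITIONAL BY NAME on the producer objects it lists (certified orbit-lower ROWS, certified
energy CAPS, kinematic cover leaves); no number of record is asserted; no `sorry`; no definition.

Cells `pub/hubbard-obs` ∧ `pub/hubbard-downfold` (MO-S2, D-0154 (1)(C) COVERAGE material (iii) NdNiO₂), seat `hubbard-cov-ndnio2-box-1`
(`prover-hubbard-cov-ndnio2-box-1-0`; hubbard-obs RULING (nnn) d310 (nnn7): «box-1 = the dischargers module + claim-node SHAPES + claim nodes /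
one-`exact` closers when certificates exist»). Companion of `Observables/RungLeavesCoverage.lean` §4 (the rung leaves `NdNiO2M21_StiffnessBoxCeiling`
= `StiffnessBoxCeilingBelow boxNdNiO2E_M21 (4779578/10⁷)`, twin `NdNiO2M22_…` bar `4418857/10⁷`; seat box-2) and of `Observables/RungLeavesCoverageNdNiO2.lean`
(one station `U_A = 5` / «L» / ladder at full box, kinematic controls; seat box-2). THE PLAN OF RECORD it serves (hubbard-cov-ndnio2-plan-1 g1 CAPTAIN
LINE 2026-08-28T05:26:15Z + sdp-1 PRETEST-U0): the leaf is ONE-BODY KINEMATICS except on the corner patch — kernel kinematic cover («KINCOVER», box-2: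
rows at `t′ = t_s ≈ −0.44`, `n = n_s ≈ 0.91`) words `T = [t_s, −9/25] × all U × all n` and `N = [−23/50, t_s] × all U × n ≤ n_s` below the bar with ZERO
solves; the RESIDUAL box `R = [−23/50, t_s] × [5, 17/2] × [n_s, 477/500]` is read from ONE f-sum STATION at the low-`U` edge `U_A = 5` (station factor
`24/17`, sources `s ∈ [−276/425, t_s]`), any density, NO `K₂` input in the two-END-objective edition.

* §1 geometry of the PEN's fallback split `U = 13/2` (`16/13 ↦ −184/325`, `21/17 ↦ −483/850`).
* §2 BAR-PARAMETRIC GLUE on `boxNdNiO2E_M21` (a director bar re-uses it; leaf instances at `4779578/10⁷`): two `U`-slab words (`…_of_twoSlabWords`), the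
  `t′`-split (`…_of_tPrimeSplit`), and the RESIDUAL COVER (`…_of_residualCover`: cell leaves on `R`, `T`, `N` with constants `≤ bar` ⇒ the shape; `t_s`,
  `n_s` free, so box-2's cover leaves plug in BY NAME whatever slot / density they certify).
* §3 STATIONS and THE CLAIM-NODE SHAPE: `ObsStiffnessSeqCeilingAt_on_box3_of_apexStation_twoEndObjectives` (the 3-D edition of unc-2's two-END station
  theorem: the density interval `[n₁, n₂] ⊂ [0, 2)` rides along); `orbitLower_of_orbitLowerRow_of_cap` (a certified orbit-lower ROW
  `SquareTTPrimeCorrOrbitLowerRow s U_A x u r univ Λ₇ (−X₀(σ, U_A))` + a certified CAP `e₀(s, U_A, x) ≤ u` ⇒ the unconditional family value `r` the station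
  engines consume — this is the sentence a boxdual bundle / box-row certificate node must carry, quantified over the SOURCE SEGMENT and the DENSITY INTERVAL
  (hubbard-cov-ndnio2-ref-1 flags f1/f2: interval-valid certificates only, never point certificates)); the leaf from TWO stations `5 ∣ U_s`
  (`…_of_twoStations_twoEndObjectives`, the two-slab Assembly in one `exact`); and THE RESIDUAL CLOSER
  `stiffnessBoxCeilingBelow_boxNdNiO2E_M21_of_residualStation5Rows_and_kinCover`: rows `rP`, `rT` under caps `u` on `[−276/425, t_s] × [n_s, 477/500]` at
  `U_A = 5` for the END objectives `−X₀(−23/50, 5)`, `−X₀(t_s, 5)`, the σ-chord price `≤ c ≤ bar`, plus the two cover leaves ⇒ `StiffnessBoxCeilingBelow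
  boxNdNiO2E_M21 bar` (leaf instance `NdNiO2M21_StiffnessBoxCeiling_of_residualStation5Rows_and_kinCover`). The CAP table `u` is load-bearing and today
  MISSING at every doped `t′ ≠ 0` point (sdp-1 W1) — it is a hypothesis here, by name.
* §4 the M22 twin: box-word discharger and two-slab glue.

References: D. J. Scalapino, S. R. White, S.-C. Zhang, PRB 47 (1993) 7995, §II [ScalapinoWhiteZhang1993]; T. Koma, H. Tasaki, J. Stat. Phys. 76
(1994) 745, §1 [KomaTasaki1994]; T. Hazra, N. Verma, M. Randeria, PRX 9 (2019) 031049, eqs. (2)–(6) [HazraVermaRanderia2019].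
-/

noncomputable section

namespace Summit.Ventures.CertifiedManyBodySolver.Observables

open Set NonemptyInterval Filter Topology
open Summit.Ventures.CertifiedManyBodySolver.Downfold
open Summit.Ventures.CertifiedManyBodySolver.Certificates
open Literature.MathematicalPhysics.QuantumLattice Literature.MathematicalPhysics.QuantumLattice.ThermodynamicLimit
open Literature.Probability.LatticeModels
open Matrix HubbardWave0
open scoped BigOperators ComplexOrder

/-! ## §1 Geometry of the two-slab fallback -/

/-- The two-slab geometry at the PEN's proposed split `U_s = 13/2`: low slab station `U_A = 5`, `U_max = 13/2`: factor `16/13`, far source `−184/325`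
(`≈ −0.566`); high slab station `U_A = 13/2`, `U_max = 17/2`: factor `21/17`, far source `−483/850` (`≈ −0.568`). [folklore] -/
theorem ndnio2_M21_split13o2_geometry :
    (2 : ℝ) - 5 / (13 / 2) = 16 / 13 ∧ (-23 / 50 : ℝ) * (16 / 13) = -(184 / 325) ∧
      (2 : ℝ) - 13 / 2 / (17 / 2) = 21 / 17 ∧ (-23 / 50 : ℝ) * (21 / 17) = -(483 / 850) := by
  refine ⟨?_, ?_, ?_, ?_⟩ <;> norm_num

/-! ## §2 Bar-parametric glue on `boxNdNiO2E_M21` -/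

/-- **Two `U`-slabs with their own words.** Split point `U_s`; a cell leaf with constant `c₁ ≤ bar` on `[−23/50, −9/25] × [5, U_s] × [213/250, 477/500]` and one
with `c₂ ≤ bar` on `… × [U_s, 17/2] × …` give `StiffnessBoxCeilingBelow boxNdNiO2E_M21 bar` (word `max c₁ c₂`, `ObsStiffnessSeqCeilingAt.mono`, `le_total U U_s`).
[cite: ScalapinoWhiteZhang1993, §II] -/
theorem stiffnessBoxCeilingBelow_boxNdNiO2E_M21_of_twoSlabWords {bar c₁ c₂ : ℚ} {Us : ℝ} (hc₁ : c₁ ≤ bar) (hc₂ : c₂ ≤ bar)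
    (hlow : ∀ tp ∈ Set.Icc (-23 / 50 : ℝ) (-9 / 25), ∀ U ∈ Set.Icc (5 : ℝ) Us, ∀ n ∈ Set.Icc (213 / 250 : ℝ) (477 / 500),
      ObsStiffnessSeqCeilingAt tp U n c₁)
    (hhigh : ∀ tp ∈ Set.Icc (-23 / 50 : ℝ) (-9 / 25), ∀ U ∈ Set.Icc Us (17 / 2), ∀ n ∈ Set.Icc (213 / 250 : ℝ) (477 / 500),
      ObsStiffnessSeqCeilingAt tp U n c₂) :
    StiffnessBoxCeilingBelow boxNdNiO2E_M21 bar := by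
  refine stiffnessBoxCeilingBelow_boxNdNiO2E_M21_of_cellLeaf (c := max c₁ c₂) (max_le hc₁ hc₂) fun tp htp U hU n hn => ?_
  rcases le_total U Us with h | h
  · exact (hlow tp htp U ⟨hU.1, h⟩ n hn).mono (le_max_left _ _)
  · exact (hhigh tp htp U ⟨h, hU.2⟩ n hn).mono (le_max_right _ _)

/-- **The leaf from two `U`-slab words** `c₁, c₂ ≤ 0.4779578` (split point `U_s` free; the route's `LowUSlabCeiling` / `HighUSlabCeiling` shape).
[cite: ScalapinoWhiteZhang1993, §II] -/
theorem NdNiO2M21_StiffnessBoxCeiling_of_twoSlabWords {c₁ c₂ : ℚ} {Us : ℝ} (hc₁ : c₁ ≤ 4779578 / 10000000) (hc₂ : c₂ ≤ 4779578 / 10000000)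
    (hlow : ∀ tp ∈ Set.Icc (-23 / 50 : ℝ) (-9 / 25), ∀ U ∈ Set.Icc (5 : ℝ) Us, ∀ n ∈ Set.Icc (213 / 250 : ℝ) (477 / 500),
      ObsStiffnessSeqCeilingAt tp U n c₁)
    (hhigh : ∀ tp ∈ Set.Icc (-23 / 50 : ℝ) (-9 / 25), ∀ U ∈ Set.Icc Us (17 / 2), ∀ n ∈ Set.Icc (213 / 250 : ℝ) (477 / 500),
      ObsStiffnessSeqCeilingAt tp U n c₂) :
    NdNiO2M21_StiffnessBoxCeiling :=
  stiffnessBoxCeilingBelow_boxNdNiO2E_M21_of_twoSlabWords hc₁ hc₂ hlow hhigh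

/-- **The `t′`-SPLIT.** Split slot `t_s`; a certified word `c₁ ≤ bar` on the DEEP sliver `[−23/50, t_s] × [5, 17/2] × [213/250, 477/500]` and any word `c₂ ≤ bar`
on the shallow part `[t_s, −9/25] × …` (e.g. a kinematic sub-box word) give `StiffnessBoxCeilingBelow boxNdNiO2E_M21 bar`. [cite: ScalapinoWhiteZhang1993, §II] -/
theorem stiffnessBoxCeilingBelow_boxNdNiO2E_M21_of_tPrimeSplit {bar c₁ c₂ : ℚ} {ts : ℝ} (hc₁ : c₁ ≤ bar) (hc₂ : c₂ ≤ bar)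
    (hdeep : ∀ tp ∈ Set.Icc (-23 / 50 : ℝ) ts, ∀ U ∈ Set.Icc (5 : ℝ) (17 / 2), ∀ n ∈ Set.Icc (213 / 250 : ℝ) (477 / 500),
      ObsStiffnessSeqCeilingAt tp U n c₁)
    (hshallow : ∀ tp ∈ Set.Icc ts (-9 / 25), ∀ U ∈ Set.Icc (5 : ℝ) (17 / 2), ∀ n ∈ Set.Icc (213 / 250 : ℝ) (477 / 500),
      ObsStiffnessSeqCeilingAt tp U n c₂) :
    StiffnessBoxCeilingBelow boxNdNiO2E_M21 bar := by
  refine stiffnessBoxCeilingBelow_boxNdNiO2E_M21_of_cellLeaf (c := max c₁ c₂) (max_le hc₁ hc₂) fun tp htp U hU n hn => ?_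
  rcases le_total tp ts with h | h
  · exact (hdeep tp ⟨htp.1, h⟩ U hU n hn).mono (le_max_left _ _)
  · exact (hshallow tp ⟨h, htp.2⟩ U hU n hn).mono (le_max_right _ _)

/-- **The leaf from the `t′`-split** at the typed bar `0.4779578`. [cite: ScalapinoWhiteZhang1993, §II] -/
theorem NdNiO2M21_StiffnessBoxCeiling_of_tPrimeSplit {c₁ c₂ : ℚ} {ts : ℝ} (hc₁ : c₁ ≤ 4779578 / 10000000) (hc₂ : c₂ ≤ 4779578 / 10000000)
    (hdeep : ∀ tp ∈ Set.Icc (-23 / 50 : ℝ) ts, ∀ U ∈ Set.Icc (5 : ℝ) (17 / 2), ∀ n ∈ Set.Icc (213 / 250 : ℝ) (477 / 500),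
      ObsStiffnessSeqCeilingAt tp U n c₁)
    (hshallow : ∀ tp ∈ Set.Icc ts (-9 / 25), ∀ U ∈ Set.Icc (5 : ℝ) (17 / 2), ∀ n ∈ Set.Icc (213 / 250 : ℝ) (477 / 500),
      ObsStiffnessSeqCeilingAt tp U n c₂) :
    NdNiO2M21_StiffnessBoxCeiling :=
  stiffnessBoxCeilingBelow_boxNdNiO2E_M21_of_tPrimeSplit hc₁ hc₂ hdeep hshallow

/-- **THE RESIDUAL COVER.** Split slot `t_s` and split density `n_s`; three cell leaves with constants `≤ bar` — `c_R` on the RESIDUAL box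
`R = [−23/50, t_s] × [5, 17/2] × [n_s, 477/500]` (the certified piece), `c_T` on `T = [t_s, −9/25] × [5, 17/2] × [213/250, 477/500]` and `c_N` on
`N = [−23/50, t_s] × [5, 17/2] × [213/250, n_s]` (the two KINEMATIC COVER pieces, box-2's «KINCOVER» leaves by name) ⇒ `StiffnessBoxCeilingBelow boxNdNiO2E_M21 bar`
(word `max c_R (max c_T c_N)`). Shape-agnostic in `t_s`, `n_s`. [cite: ScalapinoWhiteZhang1993, §II] -/
theorem stiffnessBoxCeilingBelow_boxNdNiO2E_M21_of_residualCover {bar cR cT cN : ℚ} {ts ns : ℝ} (hcR : cR ≤ bar) (hcT : cT ≤ bar)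
    (hcN : cN ≤ bar)
    (hR : ∀ tp ∈ Set.Icc (-23 / 50 : ℝ) ts, ∀ U ∈ Set.Icc (5 : ℝ) (17 / 2), ∀ n ∈ Set.Icc ns (477 / 500),
      ObsStiffnessSeqCeilingAt tp U n cR)
    (hT : ∀ tp ∈ Set.Icc ts (-9 / 25), ∀ U ∈ Set.Icc (5 : ℝ) (17 / 2), ∀ n ∈ Set.Icc (213 / 250 : ℝ) (477 / 500),
      ObsStiffnessSeqCeilingAt tp U n cT)
    (hN : ∀ tp ∈ Set.Icc (-23 / 50 : ℝ) ts, ∀ U ∈ Set.Icc (5 : ℝ) (17 / 2), ∀ n ∈ Set.Icc (213 / 250 : ℝ) ns,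
      ObsStiffnessSeqCeilingAt tp U n cN) :
    StiffnessBoxCeilingBelow boxNdNiO2E_M21 bar := by
  refine stiffnessBoxCeilingBelow_boxNdNiO2E_M21_of_cellLeaf (c := max cR (max cT cN)) (max_le hcR (max_le hcT hcN))
    fun tp htp U hU n hn => ?_
  rcases le_total tp ts with ht | ht
  · rcases le_total ns n with hn' | hn'
    · exact (hR tp ⟨htp.1, ht⟩ U hU n ⟨hn', hn.2⟩).mono (le_max_left _ _)
    · exact (hN tp ⟨htp.1, ht⟩ U hU n ⟨hn.1, hn'⟩).mono ((le_max_right cT cN).trans (le_max_right cR _))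
  · exact (hT tp ⟨ht, htp.2⟩ U hU n hn).mono ((le_max_left cT cN).trans (le_max_right cR _))

/-- **The leaf from the residual cover** at the typed bar `0.4779578`. [cite: ScalapinoWhiteZhang1993, §II] -/
theorem NdNiO2M21_StiffnessBoxCeiling_of_residualCover {cR cT cN : ℚ} {ts ns : ℝ} (hcR : cR ≤ 4779578 / 10000000)
    (hcT : cT ≤ 4779578 / 10000000) (hcN : cN ≤ 4779578 / 10000000)
    (hR : ∀ tp ∈ Set.Icc (-23 / 50 : ℝ) ts, ∀ U ∈ Set.Icc (5 : ℝ) (17 / 2), ∀ n ∈ Set.Icc ns (477 / 500),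
      ObsStiffnessSeqCeilingAt tp U n cR)
    (hT : ∀ tp ∈ Set.Icc ts (-9 / 25), ∀ U ∈ Set.Icc (5 : ℝ) (17 / 2), ∀ n ∈ Set.Icc (213 / 250 : ℝ) (477 / 500),
      ObsStiffnessSeqCeilingAt tp U n cT)
    (hN : ∀ tp ∈ Set.Icc (-23 / 50 : ℝ) ts, ∀ U ∈ Set.Icc (5 : ℝ) (17 / 2), ∀ n ∈ Set.Icc (213 / 250 : ℝ) ns,
      ObsStiffnessSeqCeilingAt tp U n cN) :
    NdNiO2M21_StiffnessBoxCeiling :=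
  stiffnessBoxCeilingBelow_boxNdNiO2E_M21_of_residualCover hcR hcT hcN hR hT hN

/-! ## §3 Stations: the 3-D two-END-objective edition, the claim-node shape, two stations, the residual closer -/

section Stations

variable {UA Umax p q n₁ n₂ : ℝ}

/-- **TWO ORDINARY STATION BUNDLES on the 3-D box `[p, q] × [U_A, U_max] × [n₁, n₂]`** (`[n₁, n₂] ⊂ [0, 2)`, `p < q ≤ 0`, `0 < U_A`): for every density
`x ∈ [n₁, n₂]` two unconditional orbit-lower families on the station segment `s ∈ [p(2 − U_A/U_max), q]` (torus-limit ground-state classes at `(s, U_A, x)`),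
`vP x s` for the END objective `−X₀(p, U_A)` and `vQ x s` for `−X₀(q, U_A)`, priced by the negated σ-chord `−((q − σ)vP x s + (σ − p)vQ x s)/(q − p) ≤ c` on
`σ ∈ [p, q]`, `s ∈ [σ(2 − U_A/U_max), σ]` ⇒ `ObsStiffnessSeqCeilingAt t′ U x c` on the whole 3-D box (unc-2's
`ObsStiffnessSeqCeilingAt_on_box_of_apexStation_twoEndObjectives` per density; the filling interval rides along; NO `K₂` input).
[cite: KomaTasaki1994, §1] [cite: ScalapinoWhiteZhang1993, §II] -/
theorem ObsStiffnessSeqCeilingAt_on_box3_of_apexStation_twoEndObjectives (hUA : 0 < UA) (hq : q ≤ 0) (hpq : p < q) (hn₁ : 0 ≤ n₁)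
    (hn₂ : n₂ < 2) (vP vQ : ℝ → ℝ → ℝ) (c : ℚ)
    (hP : ∀ x ∈ Set.Icc n₁ n₂, ∀ s ∈ Set.Icc (p * (2 - UA / Umax)) q,
      ∀ (ω : InfVolFermionState 2) (Ls : ℕ → ℕ) (ψ : ∀ L, Fock (Orb (FermionTorus 2 L))),
      Tendsto Ls atTop atTop →
      (∀ j, IsGroundStateInSector (hubbardTorusTT' (Ls j) 1 s UA) (rectN x (Ls j)) 0 (ψ (Ls j))) →
      (∀ j, star (ψ (Ls j)) ⬝ᵥ ψ (Ls j) = 1) → ω.IsTorusLimitOf ψ Ls →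
      vP x s ≤ ((Finset.univ : Finset (DihedralGroup 4)).card : ℝ)⁻¹ * ∑ g ∈ (Finset.univ : Finset (DihedralGroup 4)),
        (ω.expect (d4ShiftSet g 0 (Literature.Probability.LatticeModels.box 2 7))
          (fermionEmbed (PolySite.d4Emb g 0 (Literature.Probability.LatticeModels.box 2 7)) (-oddMomentObsTT p UA 0))).re)
    (hQ : ∀ x ∈ Set.Icc n₁ n₂, ∀ s ∈ Set.Icc (p * (2 - UA / Umax)) q,
      ∀ (ω : InfVolFermionState 2) (Ls : ℕ → ℕ) (ψ : ∀ L, Fock (Orb (FermionTorus 2 L))),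
      Tendsto Ls atTop atTop →
      (∀ j, IsGroundStateInSector (hubbardTorusTT' (Ls j) 1 s UA) (rectN x (Ls j)) 0 (ψ (Ls j))) →
      (∀ j, star (ψ (Ls j)) ⬝ᵥ ψ (Ls j) = 1) → ω.IsTorusLimitOf ψ Ls →
      vQ x s ≤ ((Finset.univ : Finset (DihedralGroup 4)).card : ℝ)⁻¹ * ∑ g ∈ (Finset.univ : Finset (DihedralGroup 4)),
        (ω.expect (d4ShiftSet g 0 (Literature.Probability.LatticeModels.box 2 7))
          (fermionEmbed (PolySite.d4Emb g 0 (Literature.Probability.LatticeModels.box 2 7)) (-oddMomentObsTT q UA 0))).re)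
    (hc : ∀ x ∈ Set.Icc n₁ n₂, ∀ σ ∈ Set.Icc p q, ∀ s ∈ Set.Icc (σ * (2 - UA / Umax)) σ,
      -((q - σ) / (q - p) * vP x s + (σ - p) / (q - p) * vQ x s) ≤ ((c : ℚ) : ℝ)) :
    ∀ tp ∈ Set.Icc p q, ∀ U ∈ Set.Icc UA Umax, ∀ x ∈ Set.Icc n₁ n₂, ObsStiffnessSeqCeilingAt tp U x c :=
  fun tp htp U hU x hx =>
    ObsStiffnessSeqCeilingAt_on_box_of_apexStation_twoEndObjectives hUA hq hpq (hn₁.trans hx.1) (hx.2.trans_lt hn₂) (vP x) (vQ x) c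
      (hP x hx) (hQ x hx) (hc x hx) tp htp U hU

/-- **THE CLAIM-NODE SHAPE → the engines' family.** A certified `D₄`-orbit-lower ROW at the source point `(s, U_A, x)` with cap `u` and value `r` on the
f-sum objective `−X₀(σ, U_A)` (`SquareTTPrimeCorrOrbitLowerRow s U_A x u r univ Λ₇ (−X₀(σ, U_A))`, the sentence a certificate node states) together with a
certified energy CAP `e₀(1, s, U_A, x) ≤ u` at the same point IS the unconditional orbit-lower statement (value `r`) the station engines take as `vP x s`.
[cite: ScalapinoWhiteZhang1993, §II] -/
theorem orbitLower_of_orbitLowerRow_of_cap {s UA x σ : ℝ} {u r : ℚ}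
    (hrow : SquareTTPrimeCorrOrbitLowerRow s UA x u r Finset.univ (Literature.Probability.LatticeModels.box 2 7) (-oddMomentObsTT σ UA 0))
    (hcap : energyDensityTT' 1 s UA x ≤ ((u : ℚ) : ℝ)) :
    ∀ (ω : InfVolFermionState 2) (Ls : ℕ → ℕ) (ψ : ∀ L, Fock (Orb (FermionTorus 2 L))),
      Tendsto Ls atTop atTop →
      (∀ j, IsGroundStateInSector (hubbardTorusTT' (Ls j) 1 s UA) (rectN x (Ls j)) 0 (ψ (Ls j))) →
      (∀ j, star (ψ (Ls j)) ⬝ᵥ ψ (Ls j) = 1) → ω.IsTorusLimitOf ψ Ls →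
      ((r : ℚ) : ℝ) ≤ ((Finset.univ : Finset (DihedralGroup 4)).card : ℝ)⁻¹ * ∑ g ∈ (Finset.univ : Finset (DihedralGroup 4)),
        (ω.expect (d4ShiftSet g 0 (Literature.Probability.LatticeModels.box 2 7))
          (fermionEmbed (PolySite.d4Emb g 0 (Literature.Probability.LatticeModels.box 2 7)) (-oddMomentObsTT σ UA 0))).re :=
  fun ω Ls ψ hLs hψ h1 hω => hrow ω Ls ψ hLs hψ h1 hω hcap

end Stations

/-- **The M21 leaf from TWO STATIONS (the two-slab Assembly in one `exact`).** Split point `U_s ≥ 5`; the low slab `[5, U_s]` from the station `U_A = 5`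
(families `vP₁ vQ₁` on `s ∈ [(−23/50)(2 − 5/U_s), −9/25]`, word `c₁ ≤ 0.4779578`) and the high slab `[U_s, 17/2]` from the station `U_A = U_s` (families `vP₂ vQ₂`
on `s ∈ [(−23/50)(2 − U_s/(17/2)), −9/25]`, word `c₂ ≤ 0.4779578`), each read with the two END objectives and priced by its σ-chord, densities `x ∈ [213/250, 477/500]`
⇒ `NdNiO2M21_StiffnessBoxCeiling`. At the PEN's `U_s = 13/2` the far sources are `−184/325` and `−483/850` (`ndnio2_M21_split13o2_geometry`).
[cite: KomaTasaki1994, §1] [cite: ScalapinoWhiteZhang1993, §II] -/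
theorem NdNiO2M21_StiffnessBoxCeiling_of_twoStations_twoEndObjectives {Us : ℝ} (hUs : 5 ≤ Us) (vP₁ vQ₁ vP₂ vQ₂ : ℝ → ℝ → ℝ) (c₁ c₂ : ℚ)
    (hc₁ : c₁ ≤ 4779578 / 10000000) (hc₂ : c₂ ≤ 4779578 / 10000000)
    (hP₁ : ∀ x ∈ Set.Icc (213 / 250 : ℝ) (477 / 500), ∀ s ∈ Set.Icc (-23 / 50 * (2 - 5 / Us)) (-9 / 25),
      ∀ (ω : InfVolFermionState 2) (Ls : ℕ → ℕ) (ψ : ∀ L, Fock (Orb (FermionTorus 2 L))),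
      Tendsto Ls atTop atTop →
      (∀ j, IsGroundStateInSector (hubbardTorusTT' (Ls j) 1 s 5) (rectN x (Ls j)) 0 (ψ (Ls j))) →
      (∀ j, star (ψ (Ls j)) ⬝ᵥ ψ (Ls j) = 1) → ω.IsTorusLimitOf ψ Ls →
      vP₁ x s ≤ ((Finset.univ : Finset (DihedralGroup 4)).card : ℝ)⁻¹ * ∑ g ∈ (Finset.univ : Finset (DihedralGroup 4)),
        (ω.expect (d4ShiftSet g 0 (Literature.Probability.LatticeModels.box 2 7))
          (fermionEmbed (PolySite.d4Emb g 0 (Literature.Probability.LatticeModels.box 2 7)) (-oddMomentObsTT (-23 / 50) 5 0))).re)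
    (hQ₁ : ∀ x ∈ Set.Icc (213 / 250 : ℝ) (477 / 500), ∀ s ∈ Set.Icc (-23 / 50 * (2 - 5 / Us)) (-9 / 25),
      ∀ (ω : InfVolFermionState 2) (Ls : ℕ → ℕ) (ψ : ∀ L, Fock (Orb (FermionTorus 2 L))),
      Tendsto Ls atTop atTop →
      (∀ j, IsGroundStateInSector (hubbardTorusTT' (Ls j) 1 s 5) (rectN x (Ls j)) 0 (ψ (Ls j))) →
      (∀ j, star (ψ (Ls j)) ⬝ᵥ ψ (Ls j) = 1) → ω.IsTorusLimitOf ψ Ls →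
      vQ₁ x s ≤ ((Finset.univ : Finset (DihedralGroup 4)).card : ℝ)⁻¹ * ∑ g ∈ (Finset.univ : Finset (DihedralGroup 4)),
        (ω.expect (d4ShiftSet g 0 (Literature.Probability.LatticeModels.box 2 7))
          (fermionEmbed (PolySite.d4Emb g 0 (Literature.Probability.LatticeModels.box 2 7)) (-oddMomentObsTT (-9 / 25) 5 0))).re)
    (hch₁ : ∀ x ∈ Set.Icc (213 / 250 : ℝ) (477 / 500), ∀ σ ∈ Set.Icc (-23 / 50 : ℝ) (-9 / 25), ∀ s ∈ Set.Icc (σ * (2 - 5 / Us)) σ,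
      -((-9 / 25 - σ) / (-9 / 25 - -23 / 50) * vP₁ x s + (σ - -23 / 50) / (-9 / 25 - -23 / 50) * vQ₁ x s) ≤ ((c₁ : ℚ) : ℝ))
    (hP₂ : ∀ x ∈ Set.Icc (213 / 250 : ℝ) (477 / 500), ∀ s ∈ Set.Icc (-23 / 50 * (2 - Us / (17 / 2))) (-9 / 25),
      ∀ (ω : InfVolFermionState 2) (Ls : ℕ → ℕ) (ψ : ∀ L, Fock (Orb (FermionTorus 2 L))),
      Tendsto Ls atTop atTop →
      (∀ j, IsGroundStateInSector (hubbardTorusTT' (Ls j) 1 s Us) (rectN x (Ls j)) 0 (ψ (Ls j))) →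
      (∀ j, star (ψ (Ls j)) ⬝ᵥ ψ (Ls j) = 1) → ω.IsTorusLimitOf ψ Ls →
      vP₂ x s ≤ ((Finset.univ : Finset (DihedralGroup 4)).card : ℝ)⁻¹ * ∑ g ∈ (Finset.univ : Finset (DihedralGroup 4)),
        (ω.expect (d4ShiftSet g 0 (Literature.Probability.LatticeModels.box 2 7))
          (fermionEmbed (PolySite.d4Emb g 0 (Literature.Probability.LatticeModels.box 2 7)) (-oddMomentObsTT (-23 / 50) Us 0))).re)
    (hQ₂ : ∀ x ∈ Set.Icc (213 / 250 : ℝ) (477 / 500), ∀ s ∈ Set.Icc (-23 / 50 * (2 - Us / (17 / 2))) (-9 / 25),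
      ∀ (ω : InfVolFermionState 2) (Ls : ℕ → ℕ) (ψ : ∀ L, Fock (Orb (FermionTorus 2 L))),
      Tendsto Ls atTop atTop →
      (∀ j, IsGroundStateInSector (hubbardTorusTT' (Ls j) 1 s Us) (rectN x (Ls j)) 0 (ψ (Ls j))) →
      (∀ j, star (ψ (Ls j)) ⬝ᵥ ψ (Ls j) = 1) → ω.IsTorusLimitOf ψ Ls →
      vQ₂ x s ≤ ((Finset.univ : Finset (DihedralGroup 4)).card : ℝ)⁻¹ * ∑ g ∈ (Finset.univ : Finset (DihedralGroup 4)),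
        (ω.expect (d4ShiftSet g 0 (Literature.Probability.LatticeModels.box 2 7))
          (fermionEmbed (PolySite.d4Emb g 0 (Literature.Probability.LatticeModels.box 2 7)) (-oddMomentObsTT (-9 / 25) Us 0))).re)
    (hch₂ : ∀ x ∈ Set.Icc (213 / 250 : ℝ) (477 / 500), ∀ σ ∈ Set.Icc (-23 / 50 : ℝ) (-9 / 25), ∀ s ∈ Set.Icc (σ * (2 - Us / (17 / 2))) σ,
      -((-9 / 25 - σ) / (-9 / 25 - -23 / 50) * vP₂ x s + (σ - -23 / 50) / (-9 / 25 - -23 / 50) * vQ₂ x s) ≤ ((c₂ : ℚ) : ℝ)) :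
    NdNiO2M21_StiffnessBoxCeiling := by
  refine NdNiO2M21_StiffnessBoxCeiling_of_twoSlabWords (Us := Us) hc₁ hc₂ (fun tp htp U hU n hn => ?_) (fun tp htp U hU n hn => ?_)
  · exact ObsStiffnessSeqCeilingAt_on_box3_of_apexStation_twoEndObjectives (p := -23 / 50) (q := -9 / 25) (UA := 5) (Umax := Us)
      (n₁ := 213 / 250) (n₂ := 477 / 500) (by norm_num) (by norm_num) (by norm_num) (by norm_num) (by norm_num) vP₁ vQ₁ c₁ hP₁ hQ₁ hch₁
      tp htp U hU n hn
  · exact ObsStiffnessSeqCeilingAt_on_box3_of_apexStation_twoEndObjectives (p := -23 / 50) (q := -9 / 25) (UA := Us) (Umax := 17 / 2)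
      (n₁ := 213 / 250) (n₂ := 477 / 500) (by linarith) (by norm_num) (by norm_num) (by norm_num) (by norm_num) vP₂ vQ₂ c₂ hP₂ hQ₂ hch₂
      tp htp U hU n hn

/-- **THE RESIDUAL CLOSER (claim-node shape, bar-parametric).** Split slot `t_s ∈ (−23/50, −9/25]`, split density `n_s ∈ [213/250, 477/500]`. INPUTS, all by name:
(rows) for every density `x ∈ [n_s, 477/500]` and every source `s` of the station segment `[(−23/50)(2 − 5/(17/2)), t_s]` (`= [−276/425, t_s]`) at `U_A = 5`, two
certified orbit-lower ROWS under a common CAP `u x s` — `rP x s` on the corner objective `−X₀(−23/50, 5)` and `rT x s` on the split-slot objective `−X₀(t_s, 5)`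
(interval-valid certificates: a boxdual bundle / box-row node quantified over the segment × the density interval); (caps) the certified energy CAPS
`e₀(1, s, 5, x) ≤ u x s` on the same set; (price) the negated σ-chord of `rP`, `rT` is `≤ c` for `σ ∈ [−23/50, t_s]`, `s ∈ [σ(2 − 5/(17/2)), σ]`; (cover) the two
KINEMATIC cover leaves `c_T` on `[t_s, −9/25] × [5, 17/2] × [213/250, 477/500]` and `c_N` on `[−23/50, t_s] × [5, 17/2] × [213/250, n_s]`; and `c, c_T, c_N ≤ bar`.
OUTPUT: `StiffnessBoxCeilingBelow boxNdNiO2E_M21 bar`. One station, NO `K₂` input, no lever; the residual box `[−23/50, t_s] × [5, 17/2] × [n_s, 477/500]` is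
`ObsStiffnessSeqCeilingAt_on_box3_of_apexStation_twoEndObjectives`, the rest is `…_of_residualCover`. [cite: KomaTasaki1994, §1] [cite: ScalapinoWhiteZhang1993, §II] -/
theorem stiffnessBoxCeilingBelow_boxNdNiO2E_M21_of_residualStation5Rows_and_kinCover {bar c cT cN : ℚ} {ts ns : ℝ}
    (hts : -23 / 50 < ts) (hts' : ts ≤ -9 / 25) (hns : 213 / 250 ≤ ns) (u rP rT : ℝ → ℝ → ℚ)
    (hrowP : ∀ x ∈ Set.Icc ns (477 / 500), ∀ s ∈ Set.Icc (-23 / 50 * (2 - 5 / (17 / 2 : ℝ))) ts,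
      SquareTTPrimeCorrOrbitLowerRow s 5 x (u x s) (rP x s) Finset.univ (Literature.Probability.LatticeModels.box 2 7)
        (-oddMomentObsTT (-23 / 50) 5 0))
    (hrowT : ∀ x ∈ Set.Icc ns (477 / 500), ∀ s ∈ Set.Icc (-23 / 50 * (2 - 5 / (17 / 2 : ℝ))) ts,
      SquareTTPrimeCorrOrbitLowerRow s 5 x (u x s) (rT x s) Finset.univ (Literature.Probability.LatticeModels.box 2 7)
        (-oddMomentObsTT ts 5 0))
    (hcap : ∀ x ∈ Set.Icc ns (477 / 500), ∀ s ∈ Set.Icc (-23 / 50 * (2 - 5 / (17 / 2 : ℝ))) ts,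
      energyDensityTT' 1 s 5 x ≤ ((u x s : ℚ) : ℝ))
    (hprice : ∀ x ∈ Set.Icc ns (477 / 500), ∀ σ ∈ Set.Icc (-23 / 50 : ℝ) ts, ∀ s ∈ Set.Icc (σ * (2 - 5 / (17 / 2 : ℝ))) σ,
      -((ts - σ) / (ts - -23 / 50) * ((rP x s : ℚ) : ℝ) + (σ - -23 / 50) / (ts - -23 / 50) * ((rT x s : ℚ) : ℝ)) ≤ ((c : ℚ) : ℝ))
    (hc : c ≤ bar) (hcT : cT ≤ bar) (hcN : cN ≤ bar)
    (hT : ∀ tp ∈ Set.Icc ts (-9 / 25), ∀ U ∈ Set.Icc (5 : ℝ) (17 / 2), ∀ n ∈ Set.Icc (213 / 250 : ℝ) (477 / 500),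
      ObsStiffnessSeqCeilingAt tp U n cT)
    (hN : ∀ tp ∈ Set.Icc (-23 / 50 : ℝ) ts, ∀ U ∈ Set.Icc (5 : ℝ) (17 / 2), ∀ n ∈ Set.Icc (213 / 250 : ℝ) ns,
      ObsStiffnessSeqCeilingAt tp U n cN) :
    StiffnessBoxCeilingBelow boxNdNiO2E_M21 bar := by
  refine stiffnessBoxCeilingBelow_boxNdNiO2E_M21_of_residualCover (ts := ts) (ns := ns) hc hcT hcN (fun tp htp U hU n hn => ?_) hT hN
  exact ObsStiffnessSeqCeilingAt_on_box3_of_apexStation_twoEndObjectives (p := -23 / 50) (q := ts) (UA := 5) (Umax := 17 / 2) (n₁ := ns)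
    (n₂ := 477 / 500) (by norm_num) (by linarith) hts (by linarith) (by norm_num) (fun x s => ((rP x s : ℚ) : ℝ)) (fun x s => ((rT x s : ℚ) : ℝ)) c
    (fun x hx s hs => orbitLower_of_orbitLowerRow_of_cap (hrowP x hx s hs) (hcap x hx s hs))
    (fun x hx s hs => orbitLower_of_orbitLowerRow_of_cap (hrowT x hx s hs) (hcap x hx s hs)) hprice tp htp U hU n hn

/-- **The rung leaf from the residual station rows + caps + kinematic cover** (bar `0.4779578`). [cite: KomaTasaki1994, §1] [cite: ScalapinoWhiteZhang1993, §II] -/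
theorem NdNiO2M21_StiffnessBoxCeiling_of_residualStation5Rows_and_kinCover {c cT cN : ℚ} {ts ns : ℝ}
    (hts : -23 / 50 < ts) (hts' : ts ≤ -9 / 25) (hns : 213 / 250 ≤ ns) (u rP rT : ℝ → ℝ → ℚ)
    (hrowP : ∀ x ∈ Set.Icc ns (477 / 500), ∀ s ∈ Set.Icc (-23 / 50 * (2 - 5 / (17 / 2 : ℝ))) ts,
      SquareTTPrimeCorrOrbitLowerRow s 5 x (u x s) (rP x s) Finset.univ (Literature.Probability.LatticeModels.box 2 7)
        (-oddMomentObsTT (-23 / 50) 5 0))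
    (hrowT : ∀ x ∈ Set.Icc ns (477 / 500), ∀ s ∈ Set.Icc (-23 / 50 * (2 - 5 / (17 / 2 : ℝ))) ts,
      SquareTTPrimeCorrOrbitLowerRow s 5 x (u x s) (rT x s) Finset.univ (Literature.Probability.LatticeModels.box 2 7)
        (-oddMomentObsTT ts 5 0))
    (hcap : ∀ x ∈ Set.Icc ns (477 / 500), ∀ s ∈ Set.Icc (-23 / 50 * (2 - 5 / (17 / 2 : ℝ))) ts,
      energyDensityTT' 1 s 5 x ≤ ((u x s : ℚ) : ℝ))
    (hprice : ∀ x ∈ Set.Icc ns (477 / 500), ∀ σ ∈ Set.Icc (-23 / 50 : ℝ) ts, ∀ s ∈ Set.Icc (σ * (2 - 5 / (17 / 2 : ℝ))) σ,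
      -((ts - σ) / (ts - -23 / 50) * ((rP x s : ℚ) : ℝ) + (σ - -23 / 50) / (ts - -23 / 50) * ((rT x s : ℚ) : ℝ)) ≤ ((c : ℚ) : ℝ))
    (hc : c ≤ 4779578 / 10000000) (hcT : cT ≤ 4779578 / 10000000) (hcN : cN ≤ 4779578 / 10000000)
    (hT : ∀ tp ∈ Set.Icc ts (-9 / 25), ∀ U ∈ Set.Icc (5 : ℝ) (17 / 2), ∀ n ∈ Set.Icc (213 / 250 : ℝ) (477 / 500),
      ObsStiffnessSeqCeilingAt tp U n cT)
    (hN : ∀ tp ∈ Set.Icc (-23 / 50 : ℝ) ts, ∀ U ∈ Set.Icc (5 : ℝ) (17 / 2), ∀ n ∈ Set.Icc (213 / 250 : ℝ) ns,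
      ObsStiffnessSeqCeilingAt tp U n cN) :
    NdNiO2M21_StiffnessBoxCeiling :=
  stiffnessBoxCeilingBelow_boxNdNiO2E_M21_of_residualStation5Rows_and_kinCover hts hts' hns u rP rT hrowP hrowT hcap hprice hc hcT hcN hT hN

/-- The residual station segment written out: `(−23/50)(2 − 5/(17/2)) = −276/425` (`≈ −0.6494`), i.e. the hypotheses above range over `s ∈ [−276/425, t_s]`.
[folklore] -/
theorem ndnio2_M21_residual_segment_far_end : (-23 / 50 : ℝ) * (2 - 5 / (17 / 2 : ℝ)) = -(276 / 425) := by norm_num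

/-! ## §4 Nd₀.₈Sr₀.₂NiO₂ (`boxNdSrNiO2E_M22`): the twin's box-word discharger and two-slab glue -/

/-- **Twin: discharger from a box word** (`HoldsOn … boxNdSrNiO2E_M22` with `c ≤ 0.4418857`). [cite: ScalapinoWhiteZhang1993, §II] -/
theorem NdNiO2M22_StiffnessBoxCeiling_of_holdsOn {c : ℚ} (hc : c ≤ 4418857 / 10000000)
    (h : HoldsOn (fun p : OneBandCoord → ℝ => ObsStiffnessSeqCeilingAt (p .tpOverT) (p .UOverT) (p .filling) c) boxNdSrNiO2E_M22) :
    NdNiO2M22_StiffnessBoxCeiling :=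
  stiffnessBoxCeilingBelow_of_holdsOn hc h

/-- **Twin: two `U`-slabs with their own words** `c₁, c₂ ≤ bar` on `[−23/50, −9/25] × [5, U_s] × [359/500, 409/500]` and `… × [U_s, 17/2] × …` ⇒
`StiffnessBoxCeilingBelow boxNdSrNiO2E_M22 bar`. [cite: ScalapinoWhiteZhang1993, §II] -/
theorem stiffnessBoxCeilingBelow_boxNdSrNiO2E_M22_of_twoSlabWords {bar c₁ c₂ : ℚ} {Us : ℝ} (hc₁ : c₁ ≤ bar) (hc₂ : c₂ ≤ bar)
    (hlow : ∀ tp ∈ Set.Icc (-23 / 50 : ℝ) (-9 / 25), ∀ U ∈ Set.Icc (5 : ℝ) Us, ∀ n ∈ Set.Icc (359 / 500 : ℝ) (409 / 500),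
      ObsStiffnessSeqCeilingAt tp U n c₁)
    (hhigh : ∀ tp ∈ Set.Icc (-23 / 50 : ℝ) (-9 / 25), ∀ U ∈ Set.Icc Us (17 / 2), ∀ n ∈ Set.Icc (359 / 500 : ℝ) (409 / 500),
      ObsStiffnessSeqCeilingAt tp U n c₂) :
    StiffnessBoxCeilingBelow boxNdSrNiO2E_M22 bar := by
  refine stiffnessBoxCeilingBelow_boxNdSrNiO2E_M22_of_cellLeaf (c := max c₁ c₂) (max_le hc₁ hc₂) fun tp htp U hU n hn => ?_
  rcases le_total U Us with h | h
  · exact (hlow tp htp U ⟨hU.1, h⟩ n hn).mono (le_max_left _ _)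
  · exact (hhigh tp htp U ⟨h, hU.2⟩ n hn).mono (le_max_right _ _)

/-- **The twin leaf from two `U`-slab words** `c₁, c₂ ≤ 0.4418857`. [cite: ScalapinoWhiteZhang1993, §II] -/
theorem NdNiO2M22_StiffnessBoxCeiling_of_twoSlabWords {c₁ c₂ : ℚ} {Us : ℝ} (hc₁ : c₁ ≤ 4418857 / 10000000) (hc₂ : c₂ ≤ 4418857 / 10000000)
    (hlow : ∀ tp ∈ Set.Icc (-23 / 50 : ℝ) (-9 / 25), ∀ U ∈ Set.Icc (5 : ℝ) Us, ∀ n ∈ Set.Icc (359 / 500 : ℝ) (409 / 500),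
      ObsStiffnessSeqCeilingAt tp U n c₁)
    (hhigh : ∀ tp ∈ Set.Icc (-23 / 50 : ℝ) (-9 / 25), ∀ U ∈ Set.Icc Us (17 / 2), ∀ n ∈ Set.Icc (359 / 500 : ℝ) (409 / 500),
      ObsStiffnessSeqCeilingAt tp U n c₂) :
    NdNiO2M22_StiffnessBoxCeiling :=
  stiffnessBoxCeilingBelow_boxNdSrNiO2E_M22_of_twoSlabWords hc₁ hc₂ hlow hhigh

end Summit.Ventures.CertifiedManyBodySolver.Observables

end
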